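import Summits.CriticalPhenomena.PercolationContinuityZ3.Theorems.Transplant.SkelPhiConcExcess
import Summits.CriticalPhenomena.PercolationContinuityZ3.Theorems.Transplant.SkelConcExcessRadius
import HarnessLib

/-!
# D″ node, STRUCTURE-FREE generic layer (SHEAR-SCOPE §3.14 ruling (B″), V98; DPRIME-SCOPE L7′ params, hp-8 d1): the EXCESS RADIUS AT THE
# RUNNING PARAMETER as a function, uniform in the centre, for a bare planar map `φ : V → ℤ²` — a classical choice in
# `Skelφ.exists_excess_radius_uniform hfr hC hΔ`, with its specification in the `hR₁` shape of `Skelφ.real_rim_le_of_radius` /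
# `Skelφ.real_rim_le_of_wired_source` at EVERY centre — φ-level re-cut of `SkelConcExcessRadius` (stmt-g7; `SkelConc.excessRadiusAtK Φ`)

builds on p205010 (kernel theorem, internal audit signed; external expert review pending) — nothing in this file uses p205010.
Lane `prim-bschramm`, seat `prim-hp-8` (gen 30; V98 hp-8 column d1, p3-g7 rulings 2026-08-21T03:54:39Z (1) / 04:07:10Z (1)); helper file
(`--supports stmt-CriticalPhenomena-4575`).  Data over `(hfr, hΔ)` (K2.3): the radius is a function of the frames hypothesis
`hfr : Skelφ.Frames G φ types`, the degree bound `hΔ : ∀ v, G.degree v ≤ Δ`, the planar diameter `m`, the tolerance `η`, the running parameter `q`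
and the entrance depth `ρ`; Φ2 `Skelφ.CylSubcritical G φ types q` is the regime test inside (radius `0` off the regime).
* **`Skelφ.excessRadiusAtK hfr hΔ m η q ρ`**;
* `excessRadiusAtK_spec` (all centres at once), `excessRadiusAtK_spec_at c` (= the `hR₁` hypothesis of `Skelφ.real_rim_le_of_radius` at the centre
  `c` with `R₀' := ρ`), `excessRadiusAtK_spec_succ_at c` (entrance depth `ρ + 1`), `excessRadiusAtK_spec_le` (coarser tolerance),
  `excessRadiusAtK_le_trans`, `excessRadiusAtK_of_not`;
* §2 bridge (`rfl`, regression value): `SkelConc.excessRadiusAtK_eq_skelφ` — the node of record's `SkelConc.excessRadiusAtK Φ` IS the φ-level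
  radius at `(Φ.frame, Φ.degree_le)` (same classical choice by proof irrelevance).
Call sites port from `SkelConc.*` by `Φ ↦ hfr hΔ` (K2.2/K2.3).
[cite: KozmaNitzan2024, §4 Lemma 12 (p. 24)] [cite: MartineauSevero2019, Cor. 2.2]
-/

noncomputable section

open MeasureTheory
open scoped Classical

namespace Summit.CriticalPhenomena.PercolationContinuityZ3.Theorems.Transplant

namespace Skelφ

open Literature.Probability.Percolation Literature.Probability.LatticeModels SimpleGraph
open Literature.Barriers.CriticalPhenomena (graphBall)
open Skel (excess)

variable {V : Type} [Countable V] {G : SimpleGraph V} [G.LocallyFinite] {φ : V → Site 2} {types : Finset V} {Δ : ℕ}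

/-! ## §1 The radius and its specifications -/

/-- **The excess radius at the running parameter `q`** (planar diameter `m`, tolerance `η`, entrance depth `ρ`), uniform over the centre:
the radius of `Skelφ.exists_excess_radius_uniform hfr hC hΔ` when `CylSubcritical G φ types q ∧ 0 < η`, else `0` (φ-level form of
`SkelConc.excessRadiusAtK`). [cite: KozmaNitzan2024, §4 Lemma 12 (p. 24)] [cite: MartineauSevero2019, Cor. 2.2] -/
def excessRadiusAtK (hfr : Frames G φ types) (hΔ : ∀ v, G.degree v ≤ Δ) (m : ℕ) (η : ℝ) (q : unitInterval) (ρ : ℕ) : ℕ :=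
  if h : CylSubcritical G φ types q ∧ 0 < η then Classical.choose (exists_excess_radius_uniform hfr h.1 hΔ ρ m h.2) else 0

/-- **Specification, all centres at once**: beyond `excessRadiusAtK hfr hΔ m η q ρ`, at EVERY centre `c`, every habitat `D ⊆ B_G(c, Rw)` of
planar diameter `≤ m` with entrances `A ⊆ D` at depth `≤ ρ` from `c` has `P_q(excess c R D A) ≤ η`. [cite: KozmaNitzan2024, §4 Lemma 12 (p. 24)] -/
theorem excessRadiusAtK_spec (hfr : Frames G φ types) (hΔ : ∀ v, G.degree v ≤ Δ) (m : ℕ) {η : ℝ} (hη : 0 < η) {q : unitInterval}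
    (hC : CylSubcritical G φ types q) (ρ : ℕ) :
    ∀ (c : V) (R : ℕ), excessRadiusAtK hfr hΔ m η q ρ ≤ R → ∀ (Rw : ℕ) (D A : Finset V), (∀ d ∈ D, d ∈ graphBall G c Rw) →
      (∀ d ∈ D, ∀ d' ∈ D, φ d - φ d' ∈ box 2 m) → A ⊆ D → (∀ a ∈ A, a ∈ graphBall G c ρ) →
        (bondPercolation G q).real (excess G c R D A) ≤ η := by
  have h : CylSubcritical G φ types q ∧ 0 < η := ⟨hC, hη⟩
  rw [excessRadiusAtK, dif_pos h]
  exact Classical.choose_spec (exists_excess_radius_uniform hfr h.1 hΔ ρ m h.2)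

/-- **Specification at one centre `c`** — literally the `hR₁` hypothesis of `Skelφ.real_rim_le_of_radius` / `real_rim_le_of_wired_source` with
`R₀' := ρ` and `R₁ := excessRadiusAtK hfr hΔ m η q ρ`. [folklore] -/
theorem excessRadiusAtK_spec_at (hfr : Frames G φ types) (hΔ : ∀ v, G.degree v ≤ Δ) (m : ℕ) {η : ℝ} (hη : 0 < η) {q : unitInterval}
    (hC : CylSubcritical G φ types q) (ρ : ℕ) (c : V) :
    ∀ R, excessRadiusAtK hfr hΔ m η q ρ ≤ R → ∀ (Rw : ℕ) (D A : Finset V), (∀ d ∈ D, d ∈ graphBall G c Rw) →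
      (∀ d ∈ D, ∀ d' ∈ D, φ d - φ d' ∈ box 2 m) → A ⊆ D → (∀ a ∈ A, a ∈ graphBall G c ρ) →
        (bondPercolation G q).real (excess G c R D A) ≤ η :=
  excessRadiusAtK_spec hfr hΔ m hη hC ρ c

/-- **The entrance-depth-`ρ + 1` form at one centre** (the product's `R₁ ρ := Rex (ρ + 1)`). [folklore] -/
theorem excessRadiusAtK_spec_succ_at (hfr : Frames G φ types) (hΔ : ∀ v, G.degree v ≤ Δ) (m : ℕ) {η : ℝ} (hη : 0 < η)
    {q : unitInterval} (hC : CylSubcritical G φ types q) (c : V) :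
    ∀ ρ R, excessRadiusAtK hfr hΔ m η q (ρ + 1) ≤ R → ∀ (Rw : ℕ) (D A : Finset V), (∀ d ∈ D, d ∈ graphBall G c Rw) →
      (∀ d ∈ D, ∀ d' ∈ D, φ d - φ d' ∈ box 2 m) → A ⊆ D → (∀ a ∈ A, a ∈ graphBall G c (ρ + 1)) →
        (bondPercolation G q).real (excess G c R D A) ≤ η :=
  fun ρ => excessRadiusAtK_spec_at hfr hΔ m hη hC (ρ + 1) c

/-- The specification transferred to a COARSER tolerance `η ≤ η'` (one radius at the minimal tolerance serves every residue). [folklore] -/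
theorem excessRadiusAtK_spec_le (hfr : Frames G φ types) (hΔ : ∀ v, G.degree v ≤ Δ) (m : ℕ) {η η' : ℝ} (hη : 0 < η) (hη' : η ≤ η')
    {q : unitInterval} (hC : CylSubcritical G φ types q) (ρ : ℕ) (c : V) :
    ∀ R, excessRadiusAtK hfr hΔ m η q ρ ≤ R → ∀ (Rw : ℕ) (D A : Finset V), (∀ d ∈ D, d ∈ graphBall G c Rw) →
      (∀ d ∈ D, ∀ d' ∈ D, φ d - φ d' ∈ box 2 m) → A ⊆ D → (∀ a ∈ A, a ∈ graphBall G c ρ) →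
        (bondPercolation G q).real (excess G c R D A) ≤ η' :=
  fun R hR Rw D A hD hm hAD hA => (excessRadiusAtK_spec_at hfr hΔ m hη hC ρ c R hR Rw D A hD hm hAD hA).trans hη'

/-- The radius is monotone-usable: any `R' ≥ R ≥ excessRadiusAtK …` also works (restatement for `omega`-side bookkeeping). [folklore] -/
theorem excessRadiusAtK_le_trans {hfr : Frames G φ types} {hΔ : ∀ v, G.degree v ≤ Δ} {m : ℕ} {η : ℝ}
    {q : unitInterval} {ρ R R' : ℕ} (h : excessRadiusAtK hfr hΔ m η q ρ ≤ R) (h' : R ≤ R') :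
    excessRadiusAtK hfr hΔ m η q ρ ≤ R' :=
  h.trans h'

/-- Off the regime (`¬ CylSubcritical q` or `η ≤ 0`) the radius is `0` (bookkeeping). [folklore] -/
theorem excessRadiusAtK_of_not (hfr : Frames G φ types) (hΔ : ∀ v, G.degree v ≤ Δ) (m : ℕ) {η : ℝ} {q : unitInterval}
    (h : ¬ (CylSubcritical G φ types q ∧ 0 < η)) (ρ : ℕ) :
    excessRadiusAtK hfr hΔ m η q ρ = 0 := by
  rw [excessRadiusAtK, dif_neg h]

end Skelφ

/-! ## §2 Bridge: the node of record's radius is the φ-level one (by `rfl`) -/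

namespace SkelConc

variable {V : Type} [Countable V] {G : SimpleGraph V} [G.LocallyFinite] (Φ : PlanarSkeletonConc G)

/-- `SkelConc.excessRadiusAtK Φ` is the φ-level `Skelφ.excessRadiusAtK` at `(Φ.frame, Φ.degree_le)` (the same classical choice, by proof
irrelevance). [folklore] -/
theorem excessRadiusAtK_eq_skelφ (m : ℕ) (η : ℝ) (q : unitInterval) (ρ : ℕ) :
    excessRadiusAtK Φ m η q ρ = Skelφ.excessRadiusAtK (G := G) (φ := Φ.φ) (types := Φ.types) Φ.frame Φ.degree_le m η q ρ := rfl

end SkelConc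

end Summit.CriticalPhenomena.PercolationContinuityZ3.Theorems.Transplant

end
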